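import Summits.AnomalousDissipation.AnomalousDissipation.Theorems.SolenoidalFractalHomogenisationLagrangianStepSidebandXChain
import Summits.AnomalousDissipation.AnomalousDissipation.Theorems.SolenoidalFractalHomogenisationLagrangianStepW7ThreeModeFibre
import Mathlib.Analysis.Calculus.Deriv.Mul
import Mathlib.Analysis.InnerProductSpace.Calculus
import HarnessLib

/-!
# K1L_D `LagrangianRenormalisationStepDesign` (stmt-AnomalousDissipation-27980), `stub_D1_V0` (V0 = clause (ii) of
# `WCrossing.D1ExactFamily`), brick T4c-1: THE RESIDUAL `r = Z − P^{(ξ)} Σⱼ ξⱼ Nⱼ x` OF THE WEAK SOLUTION AGAINST A REFERENCE RESPONSE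
# SOLVES `r' = genX·r + Def` WITH AN EXPLICIT DEFECT (helper; `--kind proof --supports stmt-AnomalousDissipation-27980 --as helper`)

Summits-side helper file of route `SolenoidalFractalHomogenisation` (prover seat `ad-k1l-cellLawV-w1` g6).  Everything proved; no definitions, no named
facts, no sorry.  Setting of FINDING F-w1g6-1 (b) (cell STATUS 2026-08-29T01:48Z; refines §4-T4 of
`Cruxes/LagrangianRenormalisationStep/Lines/onelevel-V0-exact-family.md`): THE weak solution's box vector `Z = sbVec … t` and slow mode `x = modeRep ℓ t`
(`…SidebandXChain.hasDerivAt_sbVec / hasDerivAt_slowRep`), reference responses `Nⱼ : ℝ → (ℂ³ →L[ℝ] Space R)` solving (right-, or within any set `s`)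
`Nⱼ' = Sⱼ(t) + G(t) ∘ Nⱼ` for ARBITRARY reference data `G t : Space R →L[ℂ] Space R`, `Sⱼ t : ℂ³ →L[ℂ] Space R` (for V0: `G = Sideband.gen W₁ 𝔸 γ₁ R`,
`Sⱼ = Sideband.source W₁ R j`, `Nⱼ = ` the periodic extension of `Sideband.response`), and the CLASS-TRANSVERSAL reference `z_ref = projX (Σⱼ ξⱼ • Nⱼ x)`.
* `hasDerivWithinAt_reference` — `(Σⱼ ξⱼ • Nⱼ x)' = Σⱼ ξⱼ • Sⱼ x + G (Σⱼ ξⱼ • Nⱼ x) + Σⱼ ξⱼ • Nⱼ ẋ`;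
* **`hasDerivWithinAt_residual`** — for `t ∈ (0,T)` and every set `s`,
  `HasDerivWithinAt (Z − projX(Σⱼ ξⱼ • Nⱼ x)) (genX t r + Def t) s t` with the DEFECT
  `Def = [genX t (projX y) − projX (G t y)] + Σⱼ ξⱼ • (sourceXⱼ t x − projX (Sⱼ t x)) − projX (Σⱼ ξⱼ • Nⱼ t ẋ) + tailVec t`,
  `y = Σⱼ ξⱼ • Nⱼ t x`, `ẋ = −4π² P_ℓ T_{𝔹ᵀ}(ℓ) x − Σⱼ ξⱼ • P_ℓ feedbackⱼ t Z` — the four defect groups of the refined T4: viscous/link commutator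
  (direction-Lipschitz `…TransverseSymbolLipschitz` + dissipation), source projection defect, slow variation, truncation tail.
* `residual_transversal` — the residual is class-transversal (`P_{k_z} r_z = r_z`);
* **`hasDerivWithinAt_norm_sq_of_genX`** / **`two_inner_genX_add_le`** — for ANY class-transversal `r` with `r' = genX t r + D` (within `s`):
  `(‖r‖²)' = 2⟪r, genX t r + D⟫_ℝ ≤ −8π²·lo'·Σ_z |k_z|²‖r_z‖² + 2⟪r, D⟫_ℝ` (`NearIso 𝔹 lo' hi'`; the dissipation form is kept, F-w1g6-1 (a)).
NOT a proof of any registered stub, of K1L_D, or of anomalous dissipation; rung F-D1.A0 infrastructure.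
-/

set_option linter.dupNamespace false

noncomputable section

namespace Summit.AnomalousDissipation.AnomalousDissipation.Theorems.SolenoidalFractalHomogenisation.LagrangianStep.Sideband

open Set MeasureTheory Complex UnitAddTorus
open scoped InnerProductSpace
open Literature.Analysis Literature.Analysis.FunctionSpaces Literature.Analysis.FunctionSpaces.Torus
open Literature.Analysis.FluidPDE Literature.Analysis.FluidPDE.Torus Literature.Analysis.FluidPDE.LatticeShear
open Summit.AnomalousDissipation.AnomalousDissipation.Theorems.SolenoidalFractalHomogenisation.LagrangianStep.CellChain
  (linkCoeff modeRep kdot_modeRep hasDerivAt_modeRep)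

variable {k₀ : ℕ}

/-! ## §1 The reference `y = Σⱼ ξⱼ • Nⱼ x` and its derivative -/

/-- **Derivative of the reference**: if `Nⱼ' = Sⱼ + G ∘ Nⱼ` (within `s` at `t`) and `x' = ẋ`, then
`(Σⱼ ξⱼ • Nⱼ x)' = Σⱼ ξⱼ • Sⱼ x + G (Σⱼ ξⱼ • Nⱼ x) + Σⱼ ξⱼ • Nⱼ ẋ`. [cite: SandersVerhulstMurdock2007, Lemma 5.2.7 (linear case)] -/
theorem hasDerivWithinAt_reference {R : ℕ} (ξ : Fin k₀ → ℂ) {G : ℝ → (Space R →L[ℂ] Space R)}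
    {S : Fin k₀ → ℝ → (EuclideanSpace ℂ (Fin 3) →L[ℂ] Space R)} {N : Fin k₀ → ℝ → (EuclideanSpace ℂ (Fin 3) →L[ℝ] Space R)}
    {x : ℝ → EuclideanSpace ℂ (Fin 3)} {xdot : EuclideanSpace ℂ (Fin 3)} {s : Set ℝ} {t : ℝ}
    (hN : ∀ j, HasDerivWithinAt (N j) ((S j t).restrictScalars ℝ + ((G t).restrictScalars ℝ).comp (N j t)) s t)
    (hx : HasDerivWithinAt x xdot s t) :
    HasDerivWithinAt (fun τ => ∑ j, ξ j • N j τ (x τ))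
      (∑ j, ξ j • S j t (x t) + G t (∑ j, ξ j • N j t (x t)) + ∑ j, ξ j • N j t xdot) s t := by
  have hj : ∀ j, HasDerivWithinAt (fun τ => ξ j • N j τ (x τ)) (ξ j • (S j t (x t) + G t (N j t (x t)) + N j t xdot)) s t := by
    intro j
    have h := ((hN j).clm_apply hx).const_smul (ξ j)
    refine h.congr_deriv ?_
    simp only [add_apply, ContinuousLinearMap.coe_restrictScalars', ContinuousLinearMap.comp_apply]
  have hsum := HasDerivWithinAt.fun_sum fun j (_ : j ∈ Finset.univ) => hj j
  refine hsum.congr_deriv ?_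
  rw [map_sum]
  simp only [smul_add, Finset.sum_add_distrib, map_smul]

/-! ## §2 The residual solves `r' = genX·r + Def` -/

/-- **THE RESIDUAL EQUATION**: on `(0,T)`, for THE weak solution (`Z = sbVec`, `x = modeRep ℓ`), reference responses `Nⱼ' = Sⱼ + G ∘ Nⱼ` and the
class-transversal reference `projX (Σⱼ ξⱼ • Nⱼ x)`,
`r' = genX t r + ([genX t (projX y) − projX (G t y)] + Σⱼ ξⱼ • (sourceXⱼ t x − projX (Sⱼ t x)) − projX (Σⱼ ξⱼ • Nⱼ t ẋ) + tailVec t)`.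
[cite: SandersVerhulstMurdock2007, Lemma 5.2.7 (linear case)] [cite: MajdaKramer1999, §2.2.1.3 (cell problem (49))] -/
theorem hasDerivWithinAt_residual (W₁ : LatticeWord k₀) (n : ℕ) {T : ℝ} {𝔹 : Torus.Visc4 (Fin 3)}
    {F : UnitAddTorus (Fin 3) → EuclideanSpace ℝ (Fin 3)} {u : ℝ → UnitAddTorus (Fin 3) → EuclideanSpace ℝ (Fin 3)}
    (h : Torus.IsWeakTensorPassiveVectorOn 0 T 𝔹 (W₁.cell n) F u) (hF : Integrable F volume) (ℓ : Fin 3 → ℤ) (γ₁ : ℝ) {R : ℕ}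
    (hbox : ∀ j, (W₁.phase j).m ∈ box R)
    {G : ℝ → (Space R →L[ℂ] Space R)} {S : Fin k₀ → ℝ → (EuclideanSpace ℂ (Fin 3) →L[ℂ] Space R)}
    {N : Fin k₀ → ℝ → (EuclideanSpace ℂ (Fin 3) →L[ℝ] Space R)} {s : Set ℝ} {t : ℝ} (ht : t ∈ Ioo 0 T)
    (hN : ∀ j, HasDerivWithinAt (N j) ((S j t).restrictScalars ℝ + ((G t).restrictScalars ℝ).comp (N j t)) s t) :
    HasDerivWithinAt
      (fun τ => sbVec W₁ n 𝔹 F u ℓ R τ - projX n ℓ R (∑ j, ((xiCoeff W₁ n ℓ j : ℝ) : ℂ) • N j τ (modeRep W₁ n 𝔹 F u ℓ τ)))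
      (genX W₁ n ℓ 𝔹 γ₁ R t
          (sbVec W₁ n 𝔹 F u ℓ R t - projX n ℓ R (∑ j, ((xiCoeff W₁ n ℓ j : ℝ) : ℂ) • N j t (modeRep W₁ n 𝔹 F u ℓ t))) +
        ((genX W₁ n ℓ 𝔹 γ₁ R t (projX n ℓ R (∑ j, ((xiCoeff W₁ n ℓ j : ℝ) : ℂ) • N j t (modeRep W₁ n 𝔹 F u ℓ t))) -
            projX n ℓ R (G t (∑ j, ((xiCoeff W₁ n ℓ j : ℝ) : ℂ) • N j t (modeRep W₁ n 𝔹 F u ℓ t)))) +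
          ∑ j, ((xiCoeff W₁ n ℓ j : ℝ) : ℂ) •
            (sourceX W₁ n ℓ R j t (modeRep W₁ n 𝔹 F u ℓ t) - projX n ℓ R (S j t (modeRep W₁ n 𝔹 F u ℓ t))) -
          projX n ℓ R (∑ j, ((xiCoeff W₁ n ℓ j : ℝ) : ℂ) • N j t
            (-(((4 * Real.pi ^ 2 : ℝ) : ℂ) • transversalProj ℓ (Torus.symbT (Torus.majorTranspose 𝔹) ℓ (modeRep W₁ n 𝔹 F u ℓ t))) -
              ∑ j', ((xiCoeff W₁ n ℓ j' : ℝ) : ℂ) • transversalProj ℓ (feedback W₁ R j' t (sbVec W₁ n 𝔹 F u ℓ R t)))) +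
          tailVec W₁ n 𝔹 F u ℓ R t)) s t := by
  -- the three derivatives
  have hZ := (hasDerivAt_sbVec W₁ n h hF ℓ γ₁ R ht).hasDerivWithinAt (s := s)
  have hx := (hasDerivAt_slowRep W₁ n h hF ℓ hbox ht).hasDerivWithinAt (s := s)
  have hy := hasDerivWithinAt_reference (fun j => ((xiCoeff W₁ n ℓ j : ℝ) : ℂ)) hN hx
  have hPy := ((projX n ℓ R).restrictScalars ℝ).hasFDerivAt.comp_hasDerivWithinAt t hy
  have hr := hZ.sub hPy
  refine hr.congr_deriv ?_
  -- algebra: `genX (Z − P y) = genX Z − genX (P y)`, `P` linear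
  simp only [ContinuousLinearMap.coe_restrictScalars', map_add, map_sub, map_sum, map_smul, smul_sub, Finset.sum_sub_distrib]
  abel

/-! ## §3 The residual is class-transversal; its energy has right derivative `≤ −(dissipation form) + 2⟪r, Def⟫` -/

/-- **The residual is class-transversal**: `P_{k_z}((Z − projX y)_z) = (Z − projX y)_z` on `[0,T]`. [cite: Temam1984, Ch. III §1.1] -/
theorem residual_transversal (W₁ : LatticeWord k₀) (n : ℕ) {T : ℝ} (hT : 0 ≤ T) {𝔹 : Torus.Visc4 (Fin 3)}
    {F : UnitAddTorus (Fin 3) → EuclideanSpace ℝ (Fin 3)} {u : ℝ → UnitAddTorus (Fin 3) → EuclideanSpace ℝ (Fin 3)}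
    (h : Torus.IsWeakTensorPassiveVectorOn 0 T 𝔹 (W₁.cell n) F u) (ℓ : Fin 3 → ℤ) (R : ℕ) {t : ℝ} (ht : t ∈ Icc 0 T) (y : Space R)
    (z : box R) :
    transversalProj (classFreq n ℓ z.1) ((sbVec W₁ n 𝔹 F u ℓ R t - projX n ℓ R y) z) = (sbVec W₁ n 𝔹 F u ℓ R t - projX n ℓ R y) z := by
  rw [PiLp.sub_apply, map_sub, sbVec_apply, projX_apply, transversalProj_modeRep W₁ n hT h _ ht, ThreeMode.transversalProj_idem]

/-- **The energy of a class-transversal trajectory of `r' = genX t r + D`**: `(‖r‖²)' = 2⟪r t, genX t (r t) + D⟫_ℝ` (within `s`).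
[cite: SandersVerhulstMurdock2007, Lemma 5.2.7 (linear case)] -/
theorem hasDerivWithinAt_norm_sq_of_genX (W₁ : LatticeWord k₀) (n : ℕ) (ℓ : Fin 3 → ℤ) (𝔹 : Torus.Visc4 (Fin 3)) (γ₁ : ℝ) {R : ℕ}
    {r : ℝ → Space R} {D : Space R} {s : Set ℝ} {t : ℝ} (hr : HasDerivWithinAt r (genX W₁ n ℓ 𝔹 γ₁ R t (r t) + D) s t) :
    HasDerivWithinAt (fun τ => ‖r τ‖ ^ 2) (2 * ⟪r t, genX W₁ n ℓ 𝔹 γ₁ R t (r t) + D⟫_ℝ) s t :=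
  hr.norm_sq

/-- **DISSIPATION INEQUALITY FOR THE RESIDUAL ENERGY**: for a class-transversal state `v` (`P_{k_z} v_z = v_z`), `NearIso 𝔹 lo' hi'`, and any `D`,
`2⟪v, genX t v + D⟫_ℝ ≤ −8π²·lo'·Σ_z |k_z|²·‖v_z‖² + 2⟪v, D⟫_ℝ` — the symbol form is kept (to absorb the viscous ξ-defect of the reference,
FINDING F-w1g6-1 (a)), the links are invisible, the augmentation is idle on transversal states. [cite: MajdaKramer1999, §2.2.1.3]
[cite: Giaquinta1983MultipleIntegrals, Ch. III §2 eq. (2.2)] -/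
theorem two_inner_genX_add_le (W₁ : LatticeWord k₀) (n : ℕ) (ℓ : Fin 3 → ℤ) {𝔹 : Torus.Visc4 (Fin 3)} {lo' hi' : ℝ}
    (h𝔹 : Torus.NearIso 𝔹 lo' hi') (γ₁ : ℝ) {R : ℕ} (t : ℝ) {v : Space R}
    (hv : ∀ z : box R, transversalProj (classFreq n ℓ z.1) (v z) = v z) (D : Space R) :
    2 * ⟪v, genX W₁ n ℓ 𝔹 γ₁ R t v + D⟫_ℝ ≤
      -(8 * Real.pi ^ 2 * lo') * ∑ z : box R, freqNormSq (classFreq n ℓ z.1) * ‖v z‖ ^ 2 + 2 * ⟪v, D⟫_ℝ := by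
  rw [inner_add_right, real_inner_comm]
  have h := real_inner_genX_le W₁ n ℓ h𝔹 γ₁ R t v
  simp only [hv, sub_self, Finset.sum_const_zero, mul_zero, sub_zero] at h
  nlinarith [h]

end Summit.AnomalousDissipation.AnomalousDissipation.Theorems.SolenoidalFractalHomogenisation.LagrangianStep.Sideband

end
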